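import Summits.QuantumFields.YangMills.Theorems.UnitScaleGibbsOneBondSchwingerDyson
import Summits.QuantumFields.YangMills.Theorems.UnitScaleGibbsMGFGronwall
import Summits.QuantumFields.YangMills.Theorems.UnitScaleGibbsMGFSecondMoment
import HarnessLib

/-!
# Gross's Gaussian domination for Bałaban's unit-scale Gibbs measure, ABSTRACT GAUGE GROUP:
# every action-derivative (Schwinger–Dyson) observable `X = ∂_u A` with a bounded second derivative `|∂_u X| ≤ K`
# is centred sub-Gaussian with variance proxy `K ∕ β`, for EVERY `β > 0` and every torus

Crux of record `UnitScaleTilt.HistoryTailL` (stmt-QuantumFields-19936), cell `ym3-torus` (YM ladder rung R3 = continuum SU(2) Yang–Mills on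
T³ — a RUNG, NOT the Clay problem: not d = 4, not infinite volume, not a mass gap); width seat `ym3-torus-px17` gen 7.  The NON-ABELIAN form of
L. Gross's Schwinger–Dyson proof of Gaussian domination [GrossCMP1983, Thm 2.2] (the `U(1)` sibling is ✓ `U1TorusFluxGaussianDomination`, seat px8 g9),
for the crux idea «gross-sd-transfer» (LINE 28 candidate, `Cruxes/HistoryTailL/Ideas/gross-sd-transfer.md`, annexes 1–3: stubs S_SD ∕ S_dom), on
Bałaban's types `GaugeField P 0 G`, `gibbsMeasure P β = Z⁻¹·e^{−βA}·(product Haar)`, `A = wilsonAction4` (so `T3UnitScaleTilt.gibbsK F ℰ γ K` by `rfl`),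
for an ABSTRACT gauge group `[GaugeGroup G] [MeasurableSpace G] [RegularGaugeGroup G] [HaarData G]` — no topology, no matrices.

THE DATA (exactly the rows of ✓ `UnitScaleGibbsOneBondSchwingerDyson.integral_shiftDeriv_eq_gibbsMeasure`, indexed by a finite type `ι`): bonds `b i` with
multiplicative families `k i : ℝ → G` (the one-bond left shifts `U ↦ U[b i ↦ k i t · U_{b i}]`, e.g. `k i t = exp(t·u_{b i})`, `u` a Lie-algebra-valued
bond field), the action shift-derivatives `A′ i` (measurable, bounded, `HasDerivAt` at `t = 0` at every `U`), the OBSERVABLE `X = Σ_i A′ i` — the derivative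
of the Wilson action along the left-invariant vector field `u`, «`∂_u A`» — and ITS shift-derivatives `X′ i` (measurable, bounded) with the one HYPOTHESIS OF
CONTENT `|Σ_i X′ i U| ≤ K` for all `U` (a bound on the second derivative `∂_u∂_u A`; supplied with an explicit `K(u)` for `SU(N)` by the companion file
`UnitScaleGibbsActionDerivativeGaussianDomination`).

WHAT IS PROVED (ns `…Theorems.UnitScaleGibbsSchwingerDysonGaussianDomination`; THEOREMS ONLY, 0 `def`, 0 `sorry`):
* §1 rows of the exponential observable `e^{sX}·χ` along a one-bond shift (measurable, bounded, differentiable);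
* §2 ★★ `weighted_schwingerDyson_identity` — THE SUMMED SCHWINGER–DYSON IDENTITY WITH A SHIFT-DIFFERENTIABLE WEIGHT `χ` (`β ≥ 0`, every real `s`):
  `β·∫ X e^{sX} χ dμ_β = s·∫ (Σ_i X′ i) e^{sX} χ dμ_β + ∫ e^{sX} (Σ_i χ′ i) dμ_β` — Gross's identity `β φ′(s) = s·E[e^{sX} ∂_u X]` plus the cut-off term
  (the shape LINE 28's S_SD asks with the smooth cut-off `χ_G^∞` of annex 2 §2); ★ `schwingerDyson_identity` — the case `χ ≡ 1`;
* §3 ★★★ `integral_exp_mul_le` — GAUSSIAN DOMINATION: for `β > 0` and EVERY `s ∈ ℝ`, `∫ exp(s·X) dμ_β ≤ exp(K·s²∕(2β))`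
  (§2 at `χ ≡ 1` gives `ψ′(s) = (s∕β)∫(Σ_i X′ i)e^{sX} ≤ (K∕β)·s·ψ(s)` on `s ≥ 0`, then ✓ `UnitScaleGibbsMGFGronwall.le_mul_exp_of_deriv_le_linear_mul`;
  `s ≤ 0` by reversing every direction `k i ↦ k i (−·)`, which flips `A′, X` and keeps `Σ_i X′ i`);
* (sequel `UnitScaleGibbsSchwingerDysonGaussianDominationMoments`: `∫ X dμ_β = 0`, `∫ X² dμ_β ≤ K∕β`, the two Chernoff tails `μ_β{r ≤ ±X} ≤ exp(−β r²∕(2K))`.)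

HONEST SCOPE.  Exact finite-`β` analysis for an abstract group; the hypothesis `|Σ_i X′ i| ≤ K` is where the physics sits (for the Wilson action it is the
CRUDE, configuration-free Hessian bound — the sharp `‖D_U u‖²`-form needs a small-field cut-off and is LINE 28's stub S_dom, NOT touched here).  `--supports
stmt-QuantumFields-19936 --as helper`.  Nothing of S_dom (sharp), «ShallowFluxSecondMomentL», «BlockSecondMomentL», (Q), K1, `MeanDeviationL`, `HistoryTailL`,
the rung R3, d = 4, a continuum limit or a mass gap is proved here; LINE 28 is an idea, not a registered line; the Yang–Mills mass gap is NOT proved.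

References: L. Gross, Convergence of U(1)₃ lattice gauge theory to its continuum limit, CMP 92 (1983) 137–162, Thm 2.2 and its proof [GrossCMP1983];
S. Chatterjee, Rigorous solution of strongly coupled SO(N) lattice gauge theory in the large N limit, CMP 366 (2019) §8 (Schwinger–Dyson on the group)
[Chatterjee2019LargeN]; S. Boucheron, G. Lugosi, P. Massart, Concentration Inequalities (2013) §2.2–§2.3 [BoucheronLugosiMassart2013].
-/

set_option autoImplicit false

noncomputable section

open MeasureTheory Set Filter Topology
open scoped BigOperators
open Literature.MathematicalPhysics.QuantumFieldTheory.Balaban1983to89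
open Literature.MathematicalPhysics.QuantumFieldTheory.Balaban1983to89.T4GenFunBounds (gibbsMeasure isProbabilityMeasure_gibbsMeasure)
open Summit.QuantumFields.YangMills.Theorems.UnitScaleGibbsOneBondSchwingerDyson (update_mul_zero integral_shiftDeriv_eq_gibbsMeasure)
open Summit.QuantumFields.YangMills.Theorems.UnitScaleGibbsMGFGronwall
  (le_mul_exp_of_deriv_le_linear_mul hasDerivAt_integral_exp_mul_weight integral_exp_mul_weight_pos
    measureReal_le_exp_neg_mul_integral_exp_mul_weight)
open Summit.QuantumFields.YangMills.Theorems.UnitScaleGibbsMGFSecondMoment (integrable_of_abs_le)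

namespace Summit.QuantumFields.YangMills.Theorems.UnitScaleGibbsSchwingerDysonGaussianDomination

variable {P : Params} [DecidableEq (PBond P 0)] {G : Type} [GaugeGroup G] [MeasurableSpace G] [RegularGaugeGroup G] [HaarData G]
variable {ι : Type} [Fintype ι]

/-! ## §1 Rows of the observable `X = Σ_i A′ i` and of `e^{sX}·χ` along a one-bond shift -/

omit [DecidableEq (PBond P 0)] [GaugeGroup G] [RegularGaugeGroup G] [HaarData G] in
/-- `X = Σ_i A′ i` is measurable. [folklore] -/
theorem measurable_of_eq_sum (A' : ι → GaugeField P 0 G → ℝ) (hA'm : ∀ i, Measurable (A' i))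
    (X : GaugeField P 0 G → ℝ) (hX : ∀ U, X U = ∑ i, A' i U) : Measurable X := by
  have h : X = fun U => ∑ i, A' i U := funext hX
  rw [h]
  exact Finset.measurable_sum _ fun i _ => hA'm i

omit [DecidableEq (PBond P 0)] [GaugeGroup G] [MeasurableSpace G] [RegularGaugeGroup G] [HaarData G] in
/-- `X = Σ_i A′ i` is bounded: `|X| ≤ Σ_i C_i`. [folklore] -/
theorem exists_abs_le_of_eq_sum (A' : ι → GaugeField P 0 G → ℝ) (hA'b : ∀ i, ∃ C, ∀ U, |A' i U| ≤ C)
    (X : GaugeField P 0 G → ℝ) (hX : ∀ U, X U = ∑ i, A' i U) : ∃ B, 0 ≤ B ∧ ∀ U, |X U| ≤ B := by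
  choose C hC using hA'b
  refine ⟨∑ i, max (C i) 0, Finset.sum_nonneg fun i _ => le_max_right _ _, fun U => ?_⟩
  rw [hX U]
  calc |∑ i, A' i U| ≤ ∑ i, |A' i U| := Finset.abs_sum_le_sum_abs _ _
    _ ≤ ∑ i, max (C i) 0 := Finset.sum_le_sum fun i _ => (hC i U).trans (le_max_left _ _)

omit [DecidableEq (PBond P 0)] [GaugeGroup G] [MeasurableSpace G] [RegularGaugeGroup G] [HaarData G] in
/-- A finite family of bounded functions is uniformly bounded. [folklore] -/
theorem exists_uniform_bound (F : ι → GaugeField P 0 G → ℝ) (hF : ∀ i, ∃ C, ∀ U, |F i U| ≤ C) :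
    ∃ C, 0 ≤ C ∧ ∀ i U, |F i U| ≤ C := by
  choose C hC using hF
  refine ⟨∑ i, max (C i) 0, Finset.sum_nonneg fun i _ => le_max_right _ _, fun i U => ?_⟩
  calc |F i U| ≤ max (C i) 0 := (hC i U).trans (le_max_left _ _)
    _ ≤ ∑ j, max (C j) 0 := Finset.single_le_sum (fun j _ => le_max_right (C j) 0) (Finset.mem_univ i)

omit [MeasurableSpace G] [RegularGaugeGroup G] [HaarData G] [Fintype ι] in
/-- ★ **ROWS OF `e^{sX}·χ` ALONG THE SHIFT OF BOND `b i`**: if `X` has shift-derivative `X′ i` and the weight `χ` has shift-derivative `χ′ i` (at `t = 0`,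
every `U`), then `U ↦ e^{sX(U)}χ(U)` has shift-derivative `s·X′ i·e^{sX}·χ + e^{sX}·χ′ i`. [cite: GrossCMP1983, Thm 2.2 (proof)] -/
theorem hasDerivAt_exp_mul_weight_shift (b : ι → PBond P 0) (k : ι → ℝ → G) (hk : ∀ i s t, k i (s + t) = k i s * k i t)
    (X : GaugeField P 0 G → ℝ) (X' : ι → GaugeField P 0 G → ℝ)
    (hX' : ∀ i U, HasDerivAt (fun t => X (Function.update U (b i) (k i t * U (b i)))) (X' i U) 0)
    (χ : GaugeField P 0 G → ℝ) (χ' : ι → GaugeField P 0 G → ℝ)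
    (hχ' : ∀ i U, HasDerivAt (fun t => χ (Function.update U (b i) (k i t * U (b i)))) (χ' i U) 0)
    (s : ℝ) (i : ι) (U : GaugeField P 0 G) :
    HasDerivAt (fun t => Real.exp (s * X (Function.update U (b i) (k i t * U (b i)))) *
        χ (Function.update U (b i) (k i t * U (b i))))
      (s * X' i U * Real.exp (s * X U) * χ U + Real.exp (s * X U) * χ' i U) 0 := by
  have h0 : Function.update U (b i) (k i 0 * U (b i)) = U := update_mul_zero (hk i) (b i) U
  have h1 : HasDerivAt (fun t => Real.exp (s * X (Function.update U (b i) (k i t * U (b i)))))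
      (Real.exp (s * X U) * (s * X' i U)) 0 := by
    have h := ((hX' i U).const_mul s).exp
    rw [h0] at h
    exact h
  have h2 := h1.mul (hχ' i U)
  rw [h0] at h2
  exact h2.congr_deriv (by ring)

/-! ## §2 The summed Schwinger–Dyson identity -/

/-- ★★ **THE SUMMED SCHWINGER–DYSON IDENTITY WITH A SHIFT-DIFFERENTIABLE WEIGHT** (`β ≥ 0`, every real `s`).  With the data of the file docstring and a weight
`χ` (measurable, bounded, with measurable bounded shift-derivatives `χ′ i`):
`β·∫ X·e^{sX}·χ dμ_β = s·∫ (Σ_i X′ i)·e^{sX}·χ dμ_β + ∫ e^{sX}·(Σ_i χ′ i) dμ_β`.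
Proof: ✓ `integral_shiftDeriv_eq_gibbsMeasure` at `f = e^{sX}χ` for each `i` (`∫ ∂_i(e^{sX}χ) = β∫ e^{sX}χ·A′ i`), summed over `i`, with `Σ_i A′ i = X`.
This is Gross's `β φ′(s) = s·E[e^{sX}·∂_u X]` with the cut-off term displayed. [cite: GrossCMP1983, Thm 2.2 (proof); Chatterjee2019LargeN, §8] -/
theorem weighted_schwingerDyson_identity {β : ℝ} (hβ : 0 ≤ β)
    (b : ι → PBond P 0) (k : ι → ℝ → G) (hk : ∀ i s t, k i (s + t) = k i s * k i t)
    (A' : ι → GaugeField P 0 G → ℝ) (hA'm : ∀ i, Measurable (A' i)) (hA'b : ∀ i, ∃ C, ∀ U, |A' i U| ≤ C)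
    (hA' : ∀ i U, HasDerivAt (fun t => wilsonAction4 (Function.update U (b i) (k i t * U (b i)))) (A' i U) 0)
    (X : GaugeField P 0 G → ℝ) (hX : ∀ U, X U = ∑ i, A' i U)
    (X' : ι → GaugeField P 0 G → ℝ) (hX'm : ∀ i, Measurable (X' i)) (hX'b : ∀ i, ∃ C, ∀ U, |X' i U| ≤ C)
    (hX' : ∀ i U, HasDerivAt (fun t => X (Function.update U (b i) (k i t * U (b i)))) (X' i U) 0)
    (χ : GaugeField P 0 G → ℝ) (hχm : Measurable χ) {M : ℝ} (hχM : ∀ U, |χ U| ≤ M)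
    (χ' : ι → GaugeField P 0 G → ℝ) (hχ'm : ∀ i, Measurable (χ' i)) (hχ'b : ∀ i, ∃ C, ∀ U, |χ' i U| ≤ C)
    (hχ' : ∀ i U, HasDerivAt (fun t => χ (Function.update U (b i) (k i t * U (b i)))) (χ' i U) 0) (s : ℝ) :
    β * ∫ U, X U * Real.exp (s * X U) * χ U ∂gibbsMeasure P β =
      s * ∫ U, (∑ i, X' i U) * Real.exp (s * X U) * χ U ∂gibbsMeasure P β +
        ∫ U, Real.exp (s * X U) * (∑ i, χ' i U) ∂gibbsMeasure P β := by
  haveI := isProbabilityMeasure_gibbsMeasure (G := G) P hβ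
  set μ := gibbsMeasure (G := G) P β with hμ
  have hXm : Measurable X := measurable_of_eq_sum A' hA'm X hX
  obtain ⟨B, hB0, hXB⟩ := exists_abs_le_of_eq_sum A' hA'b X hX
  obtain ⟨CX, hCX0, hCX⟩ := exists_uniform_bound X' hX'b
  obtain ⟨Cχ, hCχ0, hCχ⟩ := exists_uniform_bound χ' hχ'b
  obtain ⟨CA, hCA0, hCA⟩ := exists_uniform_bound A' hA'b
  have hM0 : 0 ≤ M := (abs_nonneg _).trans (hχM 1)
  -- the observable `f = e^{sX} χ` and its shift-derivatives
  set f : GaugeField P 0 G → ℝ := fun U => Real.exp (s * X U) * χ U with hf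
  set f' : ι → GaugeField P 0 G → ℝ := fun i U => s * X' i U * Real.exp (s * X U) * χ U + Real.exp (s * X U) * χ' i U with hf'
  have hexp_le : ∀ U, Real.exp (s * X U) ≤ Real.exp (|s| * B) := fun U => by
    refine Real.exp_le_exp.2 ?_
    calc s * X U ≤ |s * X U| := le_abs_self _
      _ = |s| * |X U| := abs_mul _ _
      _ ≤ |s| * B := mul_le_mul_of_nonneg_left (hXB U) (abs_nonneg _)
  have hfm : Measurable f := ((measurable_const.mul hXm).exp).mul hχm
  have hCf : ∀ U, |f U| ≤ Real.exp (|s| * B) * M := fun U => by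
    rw [hf]; dsimp only
    rw [abs_mul, abs_of_pos (Real.exp_pos _)]
    exact mul_le_mul (hexp_le U) (hχM U) (abs_nonneg _) (Real.exp_pos _).le
  have hf'm : ∀ i, Measurable (f' i) := fun i =>
    ((((measurable_const.mul (hX'm i)).mul (measurable_const.mul hXm).exp).mul hχm)).add
      (((measurable_const.mul hXm).exp).mul (hχ'm i))
  have hCf' : ∀ i U, |f' i U| ≤ |s| * CX * Real.exp (|s| * B) * M + Real.exp (|s| * B) * Cχ := fun i U => by
    rw [hf']; dsimp only
    have h1 : |s * X' i U * Real.exp (s * X U) * χ U| ≤ |s| * CX * Real.exp (|s| * B) * M := by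
      rw [abs_mul, abs_mul, abs_mul, abs_of_pos (Real.exp_pos _)]
      have := hCX i U
      have := hχM U
      have := hexp_le U
      gcongr
    have h2 : |Real.exp (s * X U) * χ' i U| ≤ Real.exp (|s| * B) * Cχ := by
      rw [abs_mul, abs_of_pos (Real.exp_pos _)]
      exact mul_le_mul (hexp_le U) (hCχ i U) (abs_nonneg _) (Real.exp_pos _).le
    exact (abs_add_le _ _).trans (add_le_add h1 h2)
  have hf'd : ∀ i U, HasDerivAt (fun t => f (Function.update U (b i) (k i t * U (b i)))) (f' i U) 0 :=
    fun i U => hasDerivAt_exp_mul_weight_shift b k hk X X' hX' χ χ' hχ' s i U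
  -- one-bond Schwinger–Dyson for each `i`
  have hSD : ∀ i, ∫ U, f' i U ∂μ = β * ∫ U, f U * A' i U ∂μ := fun i =>
    integral_shiftDeriv_eq_gibbsMeasure hβ (b i) (hk i) f (f' i) hfm (hf'm i) hCf (hCf' i) (hf'd i)
      (A' i) (hA'm i) (hCA i) (hA' i)
  -- integrability bookkeeping
  have hif' : ∀ i, Integrable (f' i) μ := fun i => integrable_of_abs_le μ (hf'm i) (hCf' i)
  have hifA : ∀ i, Integrable (fun U => f U * A' i U) μ := fun i => by
    refine integrable_of_abs_le μ (hfm.mul (hA'm i)) (C := Real.exp (|s| * B) * M * CA) fun U => ?_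
    rw [abs_mul]
    exact mul_le_mul (hCf U) (hCA i U) (abs_nonneg _) (by positivity)
  have hi1 : ∀ i, Integrable (fun U => s * X' i U * Real.exp (s * X U) * χ U) μ := fun i => by
    refine integrable_of_abs_le μ (((measurable_const.mul (hX'm i)).mul (measurable_const.mul hXm).exp).mul hχm)
      (C := |s| * CX * Real.exp (|s| * B) * M) fun U => ?_
    rw [abs_mul, abs_mul, abs_mul, abs_of_pos (Real.exp_pos _)]
    have := hCX i U
    have := hχM U
    have := hexp_le U
    gcongr
  have hi2 : ∀ i, Integrable (fun U => Real.exp (s * X U) * χ' i U) μ := fun i => by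
    refine integrable_of_abs_le μ (((measurable_const.mul hXm).exp).mul (hχ'm i)) (C := Real.exp (|s| * B) * Cχ) fun U => ?_
    rw [abs_mul, abs_of_pos (Real.exp_pos _)]
    exact mul_le_mul (hexp_le U) (hCχ i U) (abs_nonneg _) (Real.exp_pos _).le
  -- sum the identities over `i`
  have hsum : ∑ i, ∫ U, f' i U ∂μ = β * ∑ i, ∫ U, f U * A' i U ∂μ := by
    rw [Finset.mul_sum]
    exact Finset.sum_congr rfl fun i _ => hSD i
  -- left side: `Σ_i ∫ f′ i = s ∫ (Σ X′) e^{sX} χ + ∫ e^{sX} Σ χ′`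
  have hL : ∑ i, ∫ U, f' i U ∂μ =
      s * ∫ U, (∑ i, X' i U) * Real.exp (s * X U) * χ U ∂μ + ∫ U, Real.exp (s * X U) * (∑ i, χ' i U) ∂μ := by
    have h1 : ∑ i, ∫ U, f' i U ∂μ =
        ∑ i, (∫ U, s * X' i U * Real.exp (s * X U) * χ U ∂μ + ∫ U, Real.exp (s * X U) * χ' i U ∂μ) := by
      refine Finset.sum_congr rfl fun i _ => ?_
      rw [← integral_add (hi1 i) (hi2 i)]
    rw [h1, Finset.sum_add_distrib, ← integral_finsetSum _ (fun i _ => hi1 i), ← integral_finsetSum _ (fun i _ => hi2 i),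
      ← integral_const_mul]
    congr 1
    · refine integral_congr_ae (ae_of_all _ fun U => ?_)
      dsimp only
      rw [Finset.sum_mul, Finset.sum_mul, Finset.mul_sum]
      refine Finset.sum_congr rfl fun i _ => ?_
      ring
    · refine integral_congr_ae (ae_of_all _ fun U => ?_)
      dsimp only
      rw [Finset.mul_sum]
  -- right side: `Σ_i ∫ f A′ i = ∫ X e^{sX} χ`
  have hR : ∑ i, ∫ U, f U * A' i U ∂μ = ∫ U, X U * Real.exp (s * X U) * χ U ∂μ := by
    rw [← integral_finsetSum _ (fun i _ => hifA i)]
    refine integral_congr_ae (ae_of_all _ fun U => ?_)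
    show ∑ i, f U * A' i U = X U * Real.exp (s * X U) * χ U
    rw [← Finset.mul_sum, ← hX U, hf]
    ring
  rw [← hR, ← hsum, hL]

/-- ★ **THE SUMMED SCHWINGER–DYSON IDENTITY** (no weight; `β ≥ 0`, every real `s`): `β·∫ X e^{sX} dμ_β = s·∫ (Σ_i X′ i) e^{sX} dμ_β` — Gross's
`β φ′(s) = s·E[e^{sX} ∂_u X]`. [cite: GrossCMP1983, Thm 2.2 (proof)] -/
theorem schwingerDyson_identity {β : ℝ} (hβ : 0 ≤ β)
    (b : ι → PBond P 0) (k : ι → ℝ → G) (hk : ∀ i s t, k i (s + t) = k i s * k i t)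
    (A' : ι → GaugeField P 0 G → ℝ) (hA'm : ∀ i, Measurable (A' i)) (hA'b : ∀ i, ∃ C, ∀ U, |A' i U| ≤ C)
    (hA' : ∀ i U, HasDerivAt (fun t => wilsonAction4 (Function.update U (b i) (k i t * U (b i)))) (A' i U) 0)
    (X : GaugeField P 0 G → ℝ) (hX : ∀ U, X U = ∑ i, A' i U)
    (X' : ι → GaugeField P 0 G → ℝ) (hX'm : ∀ i, Measurable (X' i)) (hX'b : ∀ i, ∃ C, ∀ U, |X' i U| ≤ C)
    (hX' : ∀ i U, HasDerivAt (fun t => X (Function.update U (b i) (k i t * U (b i)))) (X' i U) 0) (s : ℝ) :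
    β * ∫ U, X U * Real.exp (s * X U) ∂gibbsMeasure P β =
      s * ∫ U, (∑ i, X' i U) * Real.exp (s * X U) ∂gibbsMeasure P β := by
  have h := weighted_schwingerDyson_identity hβ b k hk A' hA'm hA'b hA' X hX X' hX'm hX'b hX'
    (fun _ => (1 : ℝ)) measurable_const (M := 1) (fun _ => by simp) (fun _ _ => (0 : ℝ)) (fun _ => measurable_const)
    (fun _ => ⟨0, fun _ => by simp⟩) (fun i U => by
      simpa using (hasDerivAt_const (0 : ℝ) (1 : ℝ))) s
  simpa using h

/-! ## §3 Gaussian domination -/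

/-- Gaussian domination for `s ≥ 0` (the Grönwall step on `[0, s]`). [cite: GrossCMP1983, Thm 2.2] -/
theorem integral_exp_mul_le_of_nonneg {β : ℝ} (hβ : 0 < β)
    (b : ι → PBond P 0) (k : ι → ℝ → G) (hk : ∀ i s t, k i (s + t) = k i s * k i t)
    (A' : ι → GaugeField P 0 G → ℝ) (hA'm : ∀ i, Measurable (A' i)) (hA'b : ∀ i, ∃ C, ∀ U, |A' i U| ≤ C)
    (hA' : ∀ i U, HasDerivAt (fun t => wilsonAction4 (Function.update U (b i) (k i t * U (b i)))) (A' i U) 0)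
    (X : GaugeField P 0 G → ℝ) (hX : ∀ U, X U = ∑ i, A' i U)
    (X' : ι → GaugeField P 0 G → ℝ) (hX'm : ∀ i, Measurable (X' i)) (hX'b : ∀ i, ∃ C, ∀ U, |X' i U| ≤ C)
    (hX' : ∀ i U, HasDerivAt (fun t => X (Function.update U (b i) (k i t * U (b i)))) (X' i U) 0)
    {K : ℝ} (hK : ∀ U, |∑ i, X' i U| ≤ K) {s : ℝ} (hs : 0 ≤ s) :
    ∫ U, Real.exp (s * X U) ∂gibbsMeasure P β ≤ Real.exp (K * s ^ 2 / (2 * β)) := by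
  haveI := isProbabilityMeasure_gibbsMeasure (G := G) P hβ.le
  set μ := gibbsMeasure (G := G) P β with hμ
  have hXm : Measurable X := measurable_of_eq_sum A' hA'm X hX
  obtain ⟨B, hB0, hXB⟩ := exists_abs_le_of_eq_sum A' hA'b X hX
  -- the MGF with the trivial weight `χ ≡ 1`
  have hχm : Measurable (fun _ : GaugeField P 0 G => (1 : ℝ)) := measurable_const
  have hχM : ∀ U : GaugeField P 0 G, |(fun _ : GaugeField P 0 G => (1 : ℝ)) U| ≤ 1 := fun _ => by simp
  have hχ0 : ∀ U : GaugeField P 0 G, 0 ≤ (fun _ : GaugeField P 0 G => (1 : ℝ)) U := fun _ => zero_le_one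
  have hmass : 0 < ∫ U, (fun _ : GaugeField P 0 G => (1 : ℝ)) U ∂μ := by simp
  have hgron := le_mul_exp_of_deriv_le_linear_mul
    (ψ := fun r => ∫ U, Real.exp (r * X U) * (fun _ : GaugeField P 0 G => (1 : ℝ)) U ∂μ)
    (ψ' := fun r => ∫ U, X U * Real.exp (r * X U) * (fun _ : GaugeField P 0 G => (1 : ℝ)) U ∂μ)
    (a := K / β) (Δ := 0) hs
    (fun r _ => hasDerivAt_integral_exp_mul_weight μ hXm hχm hXB hχM r)
    (fun r _ => integral_exp_mul_weight_pos μ hXm hχm hXB hχM hχ0 hmass r)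
    (fun r hr => by
      -- the Schwinger–Dyson differential inequality `ψ′(r) ≤ (K/β)·r·ψ(r)`
      have hid := schwingerDyson_identity hβ.le b k hk A' hA'm hA'b hA' X hX X' hX'm hX'b hX' r
      simp only [mul_one]
      have hψr : ∫ U, X U * Real.exp (r * X U) ∂μ = (r / β) * ∫ U, (∑ i, X' i U) * Real.exp (r * X U) ∂μ := by
        rw [div_mul_eq_mul_div, eq_div_iff hβ.ne', mul_comm _ β]
        exact hid
      rw [hψr, add_zero]
      obtain ⟨CX, -, hCX⟩ := exists_uniform_bound X' hX'b
      have hiY : Integrable (fun U => (∑ i, X' i U) * Real.exp (r * X U)) μ := by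
        refine integrable_of_abs_le μ ((Finset.measurable_sum _ fun i _ => hX'm i).mul (measurable_const.mul hXm).exp)
          (C := K * Real.exp (|r| * B)) fun U => ?_
        rw [abs_mul, abs_of_pos (Real.exp_pos _)]
        refine mul_le_mul (hK U) (Real.exp_le_exp.2 ?_) (Real.exp_pos _).le ((abs_nonneg _).trans (hK U))
        calc r * X U ≤ |r * X U| := le_abs_self _
          _ = |r| * |X U| := abs_mul _ _
          _ ≤ |r| * B := mul_le_mul_of_nonneg_left (hXB U) (abs_nonneg _)
      have hiE : Integrable (fun U => Real.exp (r * X U)) μ := by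
        refine integrable_of_abs_le μ (measurable_const.mul hXm).exp (C := Real.exp (|r| * B)) fun U => ?_
        rw [abs_of_pos (Real.exp_pos _)]
        refine Real.exp_le_exp.2 ?_
        calc r * X U ≤ |r * X U| := le_abs_self _
          _ = |r| * |X U| := abs_mul _ _
          _ ≤ |r| * B := mul_le_mul_of_nonneg_left (hXB U) (abs_nonneg _)
      have hle : ∫ U, (∑ i, X' i U) * Real.exp (r * X U) ∂μ ≤ ∫ U, K * Real.exp (r * X U) ∂μ := by
        refine integral_mono hiY (hiE.const_mul K) fun U => ?_
        exact mul_le_mul_of_nonneg_right ((le_abs_self _).trans (hK U)) (Real.exp_pos _).le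
      rw [integral_const_mul] at hle
      have hr0 : 0 ≤ r / β := div_nonneg hr.1 hβ.le
      calc r / β * ∫ U, (∑ i, X' i U) * Real.exp (r * X U) ∂μ ≤ r / β * (K * ∫ U, Real.exp (r * X U) ∂μ) :=
            mul_le_mul_of_nonneg_left hle hr0
        _ = K / β * r * ∫ U, Real.exp (r * X U) ∂μ := by ring)
  simp only [mul_one, zero_mul, Real.exp_zero, integral_const, probReal_univ, smul_eq_mul, one_mul,
    add_zero] at hgron
  calc ∫ U, Real.exp (s * X U) ∂μ ≤ Real.exp (K / β * s ^ 2 / 2) := hgron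
    _ = Real.exp (K * s ^ 2 / (2 * β)) := by congr 1; field_simp

/-- ★★★ **GROSS'S GAUSSIAN DOMINATION FOR BAŁABAN'S GIBBS MEASURE, ABSTRACT GAUGE GROUP.**  Let `β > 0`.  With the data of the file docstring — directions
`(b i, k i)`, action shift-derivatives `A′ i`, `X = Σ_i A′ i` (the observable `∂_u A`), shift-derivatives `X′ i` of `X` with `|Σ_i X′ i| ≤ K` — for EVERY real `s`:
`∫ exp(s·X) dμ_β ≤ exp(K·s²∕(2β))`.  Proof: `s ≥ 0` is `integral_exp_mul_le_of_nonneg`; for `s ≤ 0` reverse every direction (`k i ↦ k i (−·)`), which replaces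
`A′ i, X` by their negatives and leaves `Σ_i X′ i` unchanged.  No topology on `G`, no smallness of `β`, no restriction on the torus.
[cite: GrossCMP1983, Thm 2.2] -/
theorem integral_exp_mul_le {β : ℝ} (hβ : 0 < β)
    (b : ι → PBond P 0) (k : ι → ℝ → G) (hk : ∀ i s t, k i (s + t) = k i s * k i t)
    (A' : ι → GaugeField P 0 G → ℝ) (hA'm : ∀ i, Measurable (A' i)) (hA'b : ∀ i, ∃ C, ∀ U, |A' i U| ≤ C)
    (hA' : ∀ i U, HasDerivAt (fun t => wilsonAction4 (Function.update U (b i) (k i t * U (b i)))) (A' i U) 0)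
    (X : GaugeField P 0 G → ℝ) (hX : ∀ U, X U = ∑ i, A' i U)
    (X' : ι → GaugeField P 0 G → ℝ) (hX'm : ∀ i, Measurable (X' i)) (hX'b : ∀ i, ∃ C, ∀ U, |X' i U| ≤ C)
    (hX' : ∀ i U, HasDerivAt (fun t => X (Function.update U (b i) (k i t * U (b i)))) (X' i U) 0)
    {K : ℝ} (hK : ∀ U, |∑ i, X' i U| ≤ K) (s : ℝ) :
    ∫ U, Real.exp (s * X U) ∂gibbsMeasure P β ≤ Real.exp (K * s ^ 2 / (2 * β)) := by
  rcases le_or_gt 0 s with hs | hs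
  · exact integral_exp_mul_le_of_nonneg hβ b k hk A' hA'm hA'b hA' X hX X' hX'm hX'b hX' hK hs
  · -- reversed directions
    have hkr : ∀ i s t, k i (-(s + t)) = k i (-s) * k i (-t) := fun i s t => by rw [neg_add, hk]
    have hA'r : ∀ i U, HasDerivAt (fun t => wilsonAction4 (Function.update U (b i) (k i (-t) * U (b i)))) (-A' i U) 0 := by
      intro i U
      have h0 : HasDerivAt (fun t => wilsonAction4 (Function.update U (b i) (k i t * U (b i)))) (A' i U) (-0) := by
        rw [neg_zero]; exact hA' i U
      have h := h0.scomp (0 : ℝ) (hasDerivAt_neg (0 : ℝ))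
      simpa [Function.comp_def] using h
    have hXr : ∀ U, (-X U) = ∑ i, (-A' i U) := fun U => by rw [hX U, Finset.sum_neg_distrib]
    have hX'r : ∀ i U, HasDerivAt (fun t => -X (Function.update U (b i) (k i (-t) * U (b i)))) (X' i U) 0 := by
      intro i U
      have h0 : HasDerivAt (fun t => X (Function.update U (b i) (k i t * U (b i)))) (X' i U) (-0) := by
        rw [neg_zero]; exact hX' i U
      have h := (h0.scomp (0 : ℝ) (hasDerivAt_neg (0 : ℝ))).neg
      simpa [Function.comp_def, Pi.neg_def] using h
    have h := integral_exp_mul_le_of_nonneg hβ b (fun i t => k i (-t)) hkr (fun i U => -A' i U)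
      (fun i => (hA'm i).neg) (fun i => by
        obtain ⟨C, hC⟩ := hA'b i
        exact ⟨C, fun U => by rw [abs_neg]; exact hC U⟩)
      hA'r (fun U => -X U) hXr X' hX'm hX'b hX'r hK (s := -s) (by linarith)
    have he : ∀ U, Real.exp (-s * -X U) = Real.exp (s * X U) := fun U => by rw [neg_mul_neg]
    simp only [he] at h
    calc ∫ U, Real.exp (s * X U) ∂gibbsMeasure P β ≤ Real.exp (K * (-s) ^ 2 / (2 * β)) := h
      _ = Real.exp (K * s ^ 2 / (2 * β)) := by rw [neg_sq]

end Summit.QuantumFields.YangMills.Theorems.UnitScaleGibbsSchwingerDysonGaussianDomination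

end
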